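/-
Copyright (c) 2026 the pub-hodgecm-mathlib formalisation cell (harness21).  Prover seat hodgecm-mathlib-K2E1-p15 (g2), Track B ∕ K2-LIT, h413 = `stmt-HodgeConjecture-24833`,
route of record `HCCMUnconditional`, 5Res ROADCARD AMENDMENT #3∕#4 rung G7 (dealer K2E1-plan (g7) (285)): the `K′`-TYPE COMPATIBILITY LETTER `hω` (and the level letter `hK`) of
★ G7 `chi_scattering_matrix_conj_symm_level_final_cm_two` for the adelic level `Kad = ι_∞κ(K)·ι_f(K′_f)` and the character `ω = τ ∘ κ⁻¹ ∘ (·)_∞` of ★ `K2E1KTypeCharacterArchLevelU`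
— pure group theory on the product structure `U(J)(𝔸_F) = U(J)(E ⊗ ℝ) × U(J)(𝔸_{F,f})`, hypothesis-first on how the twist `c_G` acts on the two factors.
-/
import Summits.HodgeConjecture.HodgeConjecture.Theorems.K2E1KTypeCharacterArchLevelU   -- ★ (K2E1-p12 g3): `exists_kTypeCharacter` (clause (iii)), `archPart_mem_range`, `finPart_mem`; brings ★ `UnitaryGroupAdelicProduct`
import Mathlib.Analysis.Complex.Basic
import HarnessLib

/-!
# G7 — `K2E1KTypeCharacterGaloisCompatLevelU`: the Galois twist `c_G` PRESERVES the adelic level `Kad = ⟨ι_∞κ(K) ∪ ι_f(K′_f)⟩` and the `K′`-type character `ω = τ ∘ κ⁻¹ ∘ (·)_∞`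
# satisfies `conj (ω x) = ω (c_G x)` on it — the letters `hK`, `hω` of ★ `chi_scattering_matrix_conj_symm_level_final_cm_two` at `K′ := Kad`, every rank `N`, form `J`, datum `(F, E, c)`

Cell `pub/hodgecm-mathlib`, crux h413 = `stmt-HodgeConjecture-24833`, route of record `HCCMUnconditional`; dealer K2E1-plan (g7) (285) («the `hω` letter of ★ G7 p860912 ∕ G6-inst»).
THEOREMS ONLY (no `def`, no `instance`, no notation, no named-fact hypothesis, no `sorry`; default heartbeats); lane `--kind proof --supports stmt-HodgeConjecture-24833 --as helper`
(count-neutral).  Closes no socket.  Generic quadratic datum `(F, E, c)`, rank `N`, form `J`; `κ : K →* U(J)(E ⊗ ℝ)` injective (the maximal compact `K_∞`), `K′_f ≤ U(J)(𝔸_{F,f})`,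
`τ : K →* ℂ` (the `K_∞`-type); `cG : U(J)(𝔸_F) →* U(J)(𝔸_F)` ANY endomorphism (E1: the Galois twist `GL_N(c ⊗ 1)` of ★ `K2E1QuasiSplitGaloisTwistU2.exists_galTwist`).

THE MATHEMATICS ([BorelJacquet1979, §4.1]; [MoeglinWaldspurger1995, II.1.7]; [Knapp1986, VIII §3]).  `U(J)(𝔸_F) = U(J)(E ⊗ ℝ) × U(J)(𝔸_{F,f})` with `g = ι_∞(g_∞)·ι_f(g_f)` (★
`archToAdelic_mul_finAdelicToAdelic`).  On `Kad` the character `ω` of ★ `exists_kTypeCharacter` is pinned down by its FORMULA clause (iii) `∀ x, ∃ k, κ k = x_∞ ∧ x_f ∈ K′_f ∧ ω x = τ k`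
— we work hypothesis-first on that clause, so ANY such `ω` is covered.  Suppose the twist maps the archimedean generators to archimedean generators compatibly with `conj ∘ τ`:
**(harch)** `∀ k, ∃ k′, c_G(ι_∞κk) = ι_∞κk′ ∧ τ k′ = conj τ k` — and the finite generators to finite generators: **(hf)** `∀ u ∈ K′_f, ∃ u′ ∈ K′_f, c_G(ι_f u) = ι_f u′`.  Then for `x = ι_∞(κk)·ι_f(u)
∈ Kad`: `c_G x = ι_∞(κk′)·ι_f(u′) ∈ Kad` (§1 **`hK`**), `(c_G x)_∞ = κk′`, so by the formula clause and the injectivity of `κ`, `ω(c_G x) = τ k′ = conj τ k = conj ω x` (§2 **`hω`**).  For a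
UNITARY character `τ` (`‖τ‖ = 1`, so `conj τ k = (τ k)⁻¹ = τ k⁻¹`) the letter (harch) follows from the INVERSION letter **(hinv)** `c_G(ι_∞κk) = ι_∞κ(k⁻¹)` (§3) — the E1 case: at `N = 2` the
maximal compact `K_∞ = U(J₂)(ℂ) ∩ U(2)` (per complex place) is abelian, every `k = aI + bJ₂` in it is symmetric, and the twist acts as `k ↦ k̄ = (k*)ᵀ = k⁻¹`; that discharge of (hinv), and of
(hf) for `K′_f = K_f(𝔫)`, `𝔫̄ = 𝔫` (★ `K2E1GaloisTwistCongruenceLevelU`), is FILE 2 (`…GaloisCompatLevelCMTwo`).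
* §1 **`galTwist_mem_kad`** — `hK : ∀ x : ↥Kad, c_G x ∈ Kad` from (the `ι_∞`-half of) (harch) and (hf) (closure induction).
* §2 **`kTypeCharacter_conj_eq_of_galTwist`** — THE HEAD: `∃ hK, ∀ x : ↥Kad, conj (ω x) = ω ⟨c_G x, hK x⟩` (★ G7's `hK` ∧ `hω` at `K′ := Kad`, binder shape verbatim).
* §3 **`kTypeCharacter_conj_eq_of_inv`** — the unitary-character edition on (hinv), (hf).
* §4 `kTypeCharacter_galois_witness` — FED-BY: the hypotheses of §2 are jointly satisfiable (`c_G := id`, `κ := id`, `τ := 1`, `K′_f := ⊤`, `ω` from ★ `exists_kTypeCharacter`).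
HONEST LABEL: HC_CM is proved only modulo the 7 printed citations (2 remaining named inputs: hLiu418 = `stmt-HodgeConjecture-24832`, h413 = `stmt-HodgeConjecture-24833`) until rung 0
closes; this file asserts no named fact and closes no socket; count-neutral; hypothesis-first on (harch)∕(hinv), (hf) and clause (iii).

## References
* [BorelJacquet1979] A. Borel, H. Jacquet, *Automorphic forms and automorphic representations*, Proc. Symp. Pure Math. 33.1 (1979), §4.1.
* [MoeglinWaldspurger1995] C. Mœglin, J.-L. Waldspurger, *Spectral decomposition and Eisenstein series* (1995), II.1.7.
* [Knapp1986] A. W. Knapp, *Representation Theory of Semisimple Groups* (1986), VIII §3.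
-/

set_option autoImplicit false
set_option linter.dupNamespace false  -- the mandated namespace repeats the summit's segment (`HodgeConjecture.HodgeConjecture`)

noncomputable section

open Set NumberField IsDedekindDomain
open scoped ComplexConjugate
open Literature.NumberTheory.Automorphic Literature.NumberTheory.Automorphic.UnitaryGroup
open Summit.HodgeConjecture.HodgeConjecture.Cruxes.H413.K2E1KTypeCharacterArchLevelU (exists_kTypeCharacter)

namespace Summit.HodgeConjecture.HodgeConjecture.Cruxes.H413.K2E1KTypeCharacterGaloisCompatLevelU

variable {F E : Type} [Field F] [NumberField F] [Field E] [NumberField E] [Algebra F E] {c : E ≃ₐ[F] E} {N : ℕ} {J : Matrix (Fin N) (Fin N) E}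
  {K : Type*} [Group K] (κ : K →* arch F E c N J) (Kf : Subgroup (finAdelic F E c N J))

/-! ## §1 `hK`: the twist preserves the level `Kad` -/

/-- **`hK` — THE TWIST PRESERVES `Kad = ⟨ι_∞κ(K) ∪ ι_f(K′_f)⟩`**: if `c_G` maps every archimedean generator `ι_∞κk` to some `ι_∞κk′` and every finite generator `ι_f u` (`u ∈ K′_f`) to some
`ι_f u′` (`u′ ∈ K′_f`), then `c_G(Kad) ⊆ Kad` (closure induction; `c_G` is a homomorphism). [cite: BorelJacquet1979, §4.1] -/
theorem galTwist_mem_kad (cG : (adelicGroupData F E c N J).Adelic →* (adelicGroupData F E c N J).Adelic)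
    (harch : ∀ k : K, ∃ k' : K, cG ((archToAdelic F E c N J) (κ k)) = (archToAdelic F E c N J) (κ k'))
    (hf : ∀ u ∈ Kf, ∃ u' ∈ Kf, cG ((finAdelicToAdelic F E c N J) u) = (finAdelicToAdelic F E c N J) u')
    (x : ↥(Subgroup.closure ((Set.range (fun k : K => (archToAdelic F E c N J) (κ k)) ∪ (finAdelicToAdelic F E c N J) '' (Kf : Set (finAdelic F E c N J))) : Set (adelicGroupData F E c N J).Adelic))) :
    cG (x : (adelicGroupData F E c N J).Adelic) ∈ Subgroup.closure ((Set.range (fun k : K => (archToAdelic F E c N J) (κ k)) ∪ (finAdelicToAdelic F E c N J) '' (Kf : Set (finAdelic F E c N J))) : Set (adelicGroupData F E c N J).Adelic) := by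
  obtain ⟨g, hg⟩ := x
  induction hg using Subgroup.closure_induction with
  | mem g hg' =>
      rcases hg' with ⟨k, rfl⟩ | ⟨u, hu, rfl⟩
      · obtain ⟨k', hk'⟩ := harch k
        rw [hk']
        exact Subgroup.subset_closure (Or.inl ⟨k', rfl⟩)
      · obtain ⟨u', hu', h⟩ := hf u hu
        rw [h]
        exact Subgroup.subset_closure (Or.inr ⟨u', hu', rfl⟩)
  | one => rw [map_one]; exact Subgroup.one_mem _
  | mul a b _ _ iha ihb => rw [map_mul]; exact Subgroup.mul_mem _ iha ihb
  | inv a _ ih => rw [map_inv]; exact Subgroup.inv_mem _ ih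

/-! ## §2 `hω`: `conj (ω x) = ω (c_G x)` on `Kad` — the head -/

/-- **THE HEAD — `hK` AND `hω` OF ★ `chi_scattering_matrix_conj_symm_level_final_cm_two` AT `K′ := Kad`.**  For `κ` injective, ANY `ω : ↥Kad →* ℂ` with the formula clause (iii) of ★
`exists_kTypeCharacter` (`ω x = τ k` whenever `κ k = x_∞`, and `x_f ∈ K′_f`), and a twist `c_G` with (harch) `c_G(ι_∞κk) = ι_∞κk′`, `τ k′ = conj τ k` and (hf) `c_G(ι_f K′_f) ⊆ ι_f K′_f`:
**`∃ hK : c_G(Kad) ⊆ Kad, ∀ x ∈ Kad, conj (ω x) = ω ⟨c_G x, hK x⟩`** — since `x = ι_∞(κk)·ι_f(u)`, `c_G x = ι_∞(κk′)·ι_f(u′)`, `(c_G x)_∞ = κk′` (★ `archToAdelic_mul_finAdelicToAdelic`,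
`archPart_archToAdelic`, `archPart_finAdelicToAdelic`). [cite: BorelJacquet1979, §4.1] [cite: MoeglinWaldspurger1995, II.1.7] -/
theorem kTypeCharacter_conj_eq_of_galTwist (hκ : Function.Injective κ) (τ : K →* ℂ)
    (ω : ↥(Subgroup.closure ((Set.range (fun k : K => (archToAdelic F E c N J) (κ k)) ∪ (finAdelicToAdelic F E c N J) '' (Kf : Set (finAdelic F E c N J))) : Set (adelicGroupData F E c N J).Adelic)) →* ℂ)
    (hωf : ∀ x : ↥(Subgroup.closure ((Set.range (fun k : K => (archToAdelic F E c N J) (κ k)) ∪ (finAdelicToAdelic F E c N J) '' (Kf : Set (finAdelic F E c N J))) : Set (adelicGroupData F E c N J).Adelic)),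
      ∃ k : K, κ k = archPart F E c N J (x : (adelicGroupData F E c N J).Adelic) ∧ finPart F E c N J (x : (adelicGroupData F E c N J).Adelic) ∈ Kf ∧ ω x = τ k)
    (cG : (adelicGroupData F E c N J).Adelic →* (adelicGroupData F E c N J).Adelic)
    (harch : ∀ k : K, ∃ k' : K, cG ((archToAdelic F E c N J) (κ k)) = (archToAdelic F E c N J) (κ k') ∧ τ k' = conj (τ k))
    (hf : ∀ u ∈ Kf, ∃ u' ∈ Kf, cG ((finAdelicToAdelic F E c N J) u) = (finAdelicToAdelic F E c N J) u') :
    ∃ hK : ∀ x : ↥(Subgroup.closure ((Set.range (fun k : K => (archToAdelic F E c N J) (κ k)) ∪ (finAdelicToAdelic F E c N J) '' (Kf : Set (finAdelic F E c N J))) : Set (adelicGroupData F E c N J).Adelic)),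
        cG (x : (adelicGroupData F E c N J).Adelic) ∈ Subgroup.closure ((Set.range (fun k : K => (archToAdelic F E c N J) (κ k)) ∪ (finAdelicToAdelic F E c N J) '' (Kf : Set (finAdelic F E c N J))) : Set (adelicGroupData F E c N J).Adelic),
      ∀ x, conj (ω x) = ω ⟨cG (x : (adelicGroupData F E c N J).Adelic), hK x⟩ := by
  have hK := galTwist_mem_kad κ Kf cG (fun k => (harch k).imp fun k' h => h.1) hf
  refine ⟨hK, fun x => ?_⟩
  obtain ⟨k, hk, hxf, hωx⟩ := hωf x
  obtain ⟨k', hk', hτ⟩ := harch k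
  obtain ⟨u', -, hu⟩ := hf _ hxf
  -- the twisted element and its archimedean component
  have hx : (x : (adelicGroupData F E c N J).Adelic) = (archToAdelic F E c N J) (κ k) * (finAdelicToAdelic F E c N J) (finPart F E c N J (x : (adelicGroupData F E c N J).Adelic)) := by
    rw [hk, archToAdelic_mul_finAdelicToAdelic]
  have hcx : archPart F E c N J (cG (x : (adelicGroupData F E c N J).Adelic)) = κ k' := by
    rw [hx, map_mul, hk', hu, map_mul, archPart_archToAdelic, archPart_finAdelicToAdelic, mul_one]
  obtain ⟨k'', hk'', -, hω''⟩ := hωf ⟨cG (x : (adelicGroupData F E c N J).Adelic), hK x⟩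
  have hkk : k'' = k' := hκ (hk''.trans hcx)
  rw [hω'', hkk, hτ, hωx]

/-! ## §3 The unitary-character edition: the inversion letter (hinv) -/

/-- **`hω` FOR A UNITARY `K_∞`-TYPE FROM THE INVERSION LETTER**: if `‖τ k‖ = 1` for all `k` (so `conj τ k = (τ k)⁻¹ = τ k⁻¹`, Mathlib `Complex.inv_eq_conj`) and the twist INVERTS the
archimedean generators, **(hinv)** `c_G(ι_∞κk) = ι_∞κ(k⁻¹)` (E1, `N = 2`: `K_∞` abelian, `k ↦ k̄ = k⁻¹` on `U(J₂)(ℂ) ∩ U(2)`), then with (hf): `∃ hK, ∀ x ∈ Kad, conj (ω x) = ω ⟨c_G x, hK x⟩`.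
[cite: MoeglinWaldspurger1995, II.1.7] [cite: Knapp1986, VIII §3] -/
theorem kTypeCharacter_conj_eq_of_inv (hκ : Function.Injective κ) (τ : K →* ℂ) (hτ : ∀ k, ‖τ k‖ = 1)
    (ω : ↥(Subgroup.closure ((Set.range (fun k : K => (archToAdelic F E c N J) (κ k)) ∪ (finAdelicToAdelic F E c N J) '' (Kf : Set (finAdelic F E c N J))) : Set (adelicGroupData F E c N J).Adelic)) →* ℂ)
    (hωf : ∀ x : ↥(Subgroup.closure ((Set.range (fun k : K => (archToAdelic F E c N J) (κ k)) ∪ (finAdelicToAdelic F E c N J) '' (Kf : Set (finAdelic F E c N J))) : Set (adelicGroupData F E c N J).Adelic)),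
      ∃ k : K, κ k = archPart F E c N J (x : (adelicGroupData F E c N J).Adelic) ∧ finPart F E c N J (x : (adelicGroupData F E c N J).Adelic) ∈ Kf ∧ ω x = τ k)
    (cG : (adelicGroupData F E c N J).Adelic →* (adelicGroupData F E c N J).Adelic)
    (hinv : ∀ k : K, cG ((archToAdelic F E c N J) (κ k)) = (archToAdelic F E c N J) (κ k⁻¹))
    (hf : ∀ u ∈ Kf, ∃ u' ∈ Kf, cG ((finAdelicToAdelic F E c N J) u) = (finAdelicToAdelic F E c N J) u') :
    ∃ hK : ∀ x : ↥(Subgroup.closure ((Set.range (fun k : K => (archToAdelic F E c N J) (κ k)) ∪ (finAdelicToAdelic F E c N J) '' (Kf : Set (finAdelic F E c N J))) : Set (adelicGroupData F E c N J).Adelic)),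
        cG (x : (adelicGroupData F E c N J).Adelic) ∈ Subgroup.closure ((Set.range (fun k : K => (archToAdelic F E c N J) (κ k)) ∪ (finAdelicToAdelic F E c N J) '' (Kf : Set (finAdelic F E c N J))) : Set (adelicGroupData F E c N J).Adelic),
      ∀ x, conj (ω x) = ω ⟨cG (x : (adelicGroupData F E c N J).Adelic), hK x⟩ :=
  kTypeCharacter_conj_eq_of_galTwist κ Kf hκ τ ω hωf cG (fun k => ⟨k⁻¹, hinv k, by rw [map_inv, Complex.inv_eq_conj (hτ k)]⟩) hf

/-! ## §4 FED-BY witness: the hypotheses of §2 are jointly satisfiable -/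

/-- **NON-VACUITY WITNESS (chair R39 «fed-by»)**: §2 instantiated at `c_G := id`, `κ := id` on `K := U(J)(E ⊗ ℝ)`, `τ := 1`, `K′_f := ⊤`, `ω` from ★ `exists_kTypeCharacter` — every hypothesis
holds and the conclusion is inhabited (the intended `c_G` is the Galois twist; its letters (hinv)∕(hf) are FILE 2). [folklore] -/
theorem kTypeCharacter_galois_witness :
    ∃ (ω : ↥(Subgroup.closure ((Set.range (fun k : ↥(arch F E c N J) => (archToAdelic F E c N J) ((MonoidHom.id ↥(arch F E c N J)) k)) ∪ (finAdelicToAdelic F E c N J) '' ((⊤ : Subgroup (finAdelic F E c N J)) : Set (finAdelic F E c N J))) : Set (adelicGroupData F E c N J).Adelic)) →* ℂ)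
      (hK : ∀ x : ↥(Subgroup.closure ((Set.range (fun k : ↥(arch F E c N J) => (archToAdelic F E c N J) ((MonoidHom.id ↥(arch F E c N J)) k)) ∪ (finAdelicToAdelic F E c N J) '' ((⊤ : Subgroup (finAdelic F E c N J)) : Set (finAdelic F E c N J))) : Set (adelicGroupData F E c N J).Adelic)),
        (MonoidHom.id (adelicGroupData F E c N J).Adelic) (x : (adelicGroupData F E c N J).Adelic) ∈ Subgroup.closure ((Set.range (fun k : ↥(arch F E c N J) => (archToAdelic F E c N J) ((MonoidHom.id ↥(arch F E c N J)) k)) ∪ (finAdelicToAdelic F E c N J) '' ((⊤ : Subgroup (finAdelic F E c N J)) : Set (finAdelic F E c N J))) : Set (adelicGroupData F E c N J).Adelic)),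
      ∀ x, conj (ω x) = ω ⟨(MonoidHom.id (adelicGroupData F E c N J).Adelic) (x : (adelicGroupData F E c N J).Adelic), hK x⟩ := by
  obtain ⟨ω, -, -, hωf, -, -⟩ := exists_kTypeCharacter (MonoidHom.id ↥(arch F E c N J)) (⊤ : Subgroup (finAdelic F E c N J)) (fun _ _ h => h) (1 : ↥(arch F E c N J) →* ℂ)
  obtain ⟨hK, hω⟩ := kTypeCharacter_conj_eq_of_galTwist (MonoidHom.id ↥(arch F E c N J)) (⊤ : Subgroup (finAdelic F E c N J)) (fun _ _ h => h) (1 : ↥(arch F E c N J) →* ℂ) ω hωf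
    (MonoidHom.id (adelicGroupData F E c N J).Adelic) (fun k => ⟨k, rfl, by rw [MonoidHom.one_apply, map_one]⟩) (fun u hu => ⟨u, hu, rfl⟩)
  exact ⟨ω, hK, hω⟩

end Summit.HodgeConjecture.HodgeConjecture.Cruxes.H413.K2E1KTypeCharacterGaloisCompatLevelU

end
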